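import Literature.AlgebraicGeometry.AbelianSchemes.SymplecticLiftOfIsogenyTower
import Literature.AlgebraicGeometry.AbelianSchemes.AbelianSchemeOverFibreDim
import Literature.AlgebraicGeometry.AbelianSchemes.LevelStructureOfIsogeny
import Literature.AlgebraicGeometry.Motives.AbelianVarietyTorsionPointsCountProofs
import HarnessLib

/-!
# Symplectic-liftability transfers along a Hecke isogeny: the `symplectic` field of an isogeny-quotient triple
# ([Lan2013PELCompactifications] §1.3.6; [Deligne1971TravauxShimura] 4.11–4.12; [MumfordAV1970] §20)

[Lan2013PELCompactifications, Def. 1.3.6.2 (p. 80) / Lemma 1.3.6.5 (p. 81)]: a level structure `α_n` of type `(L, ⟨·,·⟩)` is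
symplectic-liftable when at every geometric point it lifts to a symplectic isomorphism `α̂ : L ⊗ ẑ ⥲ T A_s̄` — in the tree, ★
`LevelStructure.IsSymplecticLiftable`: at every geometric point and every ample witness `Θ` of the polarisation, a
`SymplecticLift` = a compatible tower `lift M : (ℤ/M)^{2g} ⥲ A_s[M](Ω)`, `N ∣ M`, of symplectic SIMILITUDES
`ē^Θ_M(lift x, lift y) = ζ_M^{E_δ(x,y)}`.  [Deligne1971TravauxShimura, 4.11–4.12 (pp. 148–149)]: the Hecke operator of
`γ ∈ GSp_{2g}(ℚ)` is the isogeny `A ↦ A/K`, `K = γ⁻¹ℤ^{2g}/ℤ^{2g}`, the quotient's marking being `a ↦ ψ(Λ(γ⁻¹a))` — a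
symplectic similitude of the SAME type because `γ` is a similitude.  So liftability TRANSFERS along such an isogeny; this is
the `symplectic` field of the quotient triple `(A/K, λ_B, ψ∘η′^ν)` that the classifying map of the Hecke correspondence needs
AT EVERY GEOMETRIC POINT of the base (not only at `ℂ`-points).

THIS FILE (theorems only; the isogeny analogue of ★ (T1)/(T2) `SymplecticLift.nonempty_transport` /
`IsSymplecticLiftable.of_fibreIso` of `AbelianSchemeSymplecticLevelTransfer`):
* `typeFormMod_intCast`, `sum_sum_typeForm_mulVec` (+ private `val_intCast_mul_eq`) — exponent arithmetic (`E_δ(γ⋆a, γ⋆b) = νE_δ(a, b)`);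
* `SymplecticLift.nonempty_of_isogeny` — THE POINTWISE ENGINE: from a symplectic lift `Λ` of the source level-`N·ν` structure
  `φ′` at `s` (witness `Θ_A`), a homomorphism `u : A → B` with induced level-`N` structure `ψφ = u ∘ φ′^ν` (★
  `LevelStructureOfIsogeny`), integer matrices `γ, γ⋆ = νγ⁻¹` (`γγ⋆ = γ⋆γ = ν`, `ᵗγ⋆E_δγ⋆ = νE_δ`, `γ ≡ 1 (mod N)` — the Hecke
  datum, ★ `SymplecticSimilitudeCoprimeInverse`), the EXACT KERNEL of `u_s` = `φ′(N·γ⋆ℤ^{2g})(s)`, `B` of relative dimension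
  `g`, and the MIXED-LEVEL WEIL CLAUSE (W′) `ē^{Θ_B}_M(u a, u b) = ē^{Θ_A}_{νM}(a, b)` (`a, b ∈ A_s[νM]`, `N ∣ M`): a symplectic
  lift of `ψφ` at `s` for `Θ_B`, type `δ` — roots `ζ′_M := ζ_{νM}^ν`, tower `lift′_M(a) := u_s(Λ.lift_{νM}(γ⋆ã))` (its
  arithmetic is ★ `SymplecticLiftOfIsogenyTower`), bijective by the exact kernel + counting (★
  `natCard_torsionPoints_eq_of_isAlgClosed`), symplectic by (W′) and `E_δ(γ⋆x, γ⋆y) = νE_δ(x, y)`;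
* `IsSymplecticLiftable.of_fibreIsogeny` — (T3) OVER THE BASE: with the kernel hypothesis at every geometric point and the
  polarisation transfer «every ample witness `Θ_B` of `λ̄_B` has an ample witness `Θ_A` of `λ̄_A` with (W′)», liftability of
  `φ′` for `λ_A` gives liftability of `ψφ` for `λ_B`;
* `exists_isSymplecticLiftable_of_fibreIsogeny` — ONE CALL: the `level` and `symplectic` fields of the quotient triple
  (★ `exists_σ_eq_pow_comp_of_coprime` + (T3)).
Single-level Weil functoriality (★ `weilPairingLevel_pullback`, [MumfordAV1970] §20 (3)) gives only `ν`-th powers of (W′)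
when `ν ∣ M`; (W′) itself follows from the descent identity `ψ^∨ ∘ λ_B ∘ ψ = ν·λ_A` of the quotient polarisation and is taken
here as a hypothesis (discharged by the file constructing `λ_B`).  Cell hodgecm-mathlib, seat B-p04 (g17), E-road HECKE-LINK
line card v1.1 socket (B) H3/H4.  HC_CM is proved only modulo the 7 printed citations until rung 0 closes; this file
discharges none of them.

## References
* [Lan2013PELCompactifications] K.-W. Lan, *Arithmetic compactifications of PEL-type Shimura varieties* (2013), §1.3.6
  Def. 1.3.6.2 (p. 80), Lemma 1.3.6.5 (p. 81), Lemma 1.3.6.6 and Cor. 1.3.6.7 (pp. 81–82).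
* [Deligne1971TravauxShimura] P. Deligne, *Travaux de Shimura*, Sém. Bourbaki 389 (1971), 4.11–4.12 (pp. 148–149).
* [MumfordAV1970] D. Mumford, *Abelian Varieties* (1970), §20, property (3) of `e_n` (p. 186); §6 App. 3 (p. 64).
* [MumfordFogartyKirwan1994] *Geometric Invariant Theory*, 3rd ed., Ch. 7 §1 Def. 7.1 (p. 129), App. 7A (p. 235).
* [Milne2005ShimuraVarieties] J. S. Milne, *Introduction to Shimura varieties* (2005), §6 pp. 67–70 (`GSp`, the multiplier).
* [GenestierNgo2020] A. Genestier, B. C. Ngô, *Lectures on Shimura varieties*, §1.3 (1.3.1).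
-/

noncomputable section

universe u

open CategoryTheory CategoryTheory.Limits AlgebraicGeometry MonoidalCategory Matrix
open scoped MonObj

namespace Literature.AlgebraicGeometry.AbelianSchemes

namespace AbelianSchemeOver

open Literature.AlgebraicGeometry.Motives
open Literature.AlgebraicGeometry.ModuliOfAbelianVarieties (typeForm)


variable {S : Scheme.{u}} {A B : AbelianSchemeOver S} {Ω : Type u} [Field Ω] (s : Spec (.of Ω) ⟶ S)

/-! ### §4 Exponent arithmetic: `E_δ(γ⋆a, γ⋆b) = ν E_δ(a, b)` and the root bookkeeping `ζ_{νM}^{ν e} = (ζ_{νM}^ν)^{e mod M}` -/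

section Arithmetic

variable {g : ℕ} (δ : Fin g → ℕ)

/-- `typeFormMod` on vectors of INTEGER residues is the residue of the integer form `Σ aᵢ (E_δ)ᵢⱼ bⱼ`.
[cite: GenestierNgo2020, §1.3 (1.3.1)] -/
theorem typeFormMod_intCast (L : ℕ) (a b : Fin g ⊕ Fin g → ℤ) :
    typeFormMod δ L (fun j => ((a j : ℤ) : ZMod L)) (fun j => ((b j : ℤ) : ZMod L)) =
      ((∑ i, ∑ j, a i * typeForm δ i j * b j : ℤ) : ZMod L) := by
  simp only [typeFormMod, Int.cast_sum, Int.cast_mul]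

/-- The integer form as a dot product: `Σᵢⱼ aᵢ Eᵢⱼ bⱼ = a ⬝ (E b)`. [cite: GenestierNgo2020, §1.3 (1.3.1)] -/
theorem sum_sum_typeForm_eq_dotProduct (a b : Fin g ⊕ Fin g → ℤ) :
    (∑ i, ∑ j, a i * typeForm δ i j * b j : ℤ) = a ⬝ᵥ (typeForm δ *ᵥ b) := by
  simp only [dotProduct, Matrix.mulVec, Finset.mul_sum, mul_assoc]

/-- **A similitude of `E_δ` with multiplier `ν` scales the integer form by `ν`**: `ᵗγ⋆ E_δ γ⋆ = ν E_δ` gives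
`E(γ⋆a, γ⋆b) = ν E(a, b)`. [cite: Milne2005ShimuraVarieties, §6 pp. 67–70 (GSp, the multiplier)] -/
theorem sum_sum_typeForm_mulVec (γs : Matrix (Fin g ⊕ Fin g) (Fin g ⊕ Fin g) ℤ) {ν : ℤ}
    (hsim : γsᵀ * typeForm δ * γs = ν • typeForm δ) (a b : Fin g ⊕ Fin g → ℤ) :
    (∑ i, ∑ j, (γs *ᵥ a) i * typeForm δ i j * (γs *ᵥ b) j : ℤ) = ν * ∑ i, ∑ j, a i * typeForm δ i j * b j := by
  rw [sum_sum_typeForm_eq_dotProduct, sum_sum_typeForm_eq_dotProduct, ← Matrix.vecMul_transpose,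
    ← Matrix.dotProduct_mulVec, Matrix.mulVec_mulVec, Matrix.mulVec_mulVec, hsim, Matrix.smul_mulVec,
    dotProduct_smul, smul_eq_mul]

/-- Root bookkeeping: for `e ∈ ℤ`, `(ν e mod νM)` as a natural number is `ν · (e mod M)`.
[folklore] -/
private theorem val_intCast_mul_eq (ν M : ℕ) [NeZero M] [NeZero (ν * M)] (e : ℤ) :
    (((ν : ℤ) * e : ℤ) : ZMod (ν * M)).val = ν * ((e : ℤ) : ZMod M).val := by
  set r := ((e : ℤ) : ZMod M).val with hr
  have hre : ((e : ℤ) : ZMod M) = ((r : ℤ) : ZMod M) := by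
    rw [Int.cast_natCast, hr, ZMod.natCast_zmod_val]
  have hdvd : (M : ℤ) ∣ (r : ℤ) - e := (ZMod.intCast_eq_intCast_iff_dvd_sub _ _ _).1 hre
  have hdvd' : ((ν * M : ℕ) : ℤ) ∣ (ν : ℤ) * (r : ℤ) - (ν : ℤ) * e := by
    rw [← mul_sub, Nat.cast_mul]
    exact mul_dvd_mul_left _ hdvd
  have hcast : (((ν : ℤ) * e : ℤ) : ZMod (ν * M)) = (((ν * r : ℕ) : ℤ) : ZMod (ν * M)) := by
    rw [ZMod.intCast_eq_intCast_iff_dvd_sub]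
    push_cast
    exact hdvd'
  rw [hcast, Int.cast_natCast, ZMod.val_natCast]
  exact Nat.mod_eq_of_lt (Nat.mul_lt_mul_of_pos_left (ZMod.val_lt _) (Nat.pos_of_ne_zero
    (fun h => (NeZero.ne (ν * M)) (by rw [h, zero_mul]))))

end Arithmetic

/-! ### §5 The engine: a symplectic lift transfers along the isogeny, at one geometric point -/

/-- `u_s` commutes with powers on `Ω`-points (Mathlib `IsMonHom.monoidHom`; private plumbing). [folklore] -/
private theorem map_fibreHom_pow' (u : A.X ⟶ B.X) [IsMonHom u] (P : (A.fibre s).toAbelianVariety.Points Ω) (n : ℕ) :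
    AlgPoints.map (fibreHom u s).hom.hom.hom (P ^ n) = AlgPoints.map (fibreHom u s).hom.hom.hom P ^ n :=
  map_pow (IsMonHom.monoidHom (fibreHom u s).hom.hom.hom (specOver Ω Ω)) P n

namespace LevelStructure.SymplecticLift

variable {g N ν : ℕ} {φ' : A.LevelStructure g (N * ν)} {s}
  {ΘA : CartierDivisor (A.fibre s).toAbelianVariety.X.left} {δ : Fin g → ℕ}

/-- **SYMPLECTIC LIFTS TRANSFER ALONG AN ISOGENY WHOSE KERNEL IS THE HECKE KERNEL `γ⁻¹ℤ^{2g}/ℤ^{2g}`** (pointwise engine of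
the `symplectic` field of a Hecke isogeny quotient; the isogeny analogue of ★ (T1) `nonempty_transport`).  Data at a
geometric point `s` (Ω algebraically closed): a symplectic lift `Λ` of the SOURCE level-`N·ν` structure `φ′` for the witness
`Θ_A`; a homomorphism `u : A → B` of abelian schemes with the TARGET level-`N` structure `ψφ = u ∘ φ′^ν` (★
`exists_σ_eq_pow_comp_of_coprime`); integer matrices `γ, γ⋆` with `γγ⋆ = γ⋆γ = ν` (`γ⋆ = νγ⁻¹`, ★
`SymplecticSimilitudeCoprimeInverse`), `ᵗγ⋆E_δγ⋆ = νE_δ` (similitude, multiplier `ν`), `γ ≡ 1 (mod N)`; the KERNEL of `u_s`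
on `Ω`-points is exactly `φ′(N·γ⋆ℤ^{2g})(s)` (the points `γ⁻¹z mod Λ`); `B` has relative dimension `g`; and the MIXED-LEVEL
WEIL CLAUSE (W′): `ē^{Θ_B}_M(u a, u b) = ē^{Θ_A}_{νM}(a, b)` for `a, b ∈ A_s[νM]` with `u a, u b ∈ B_s[M]`, `N ∣ M`.  THEN `ψφ`
has a symplectic lift at `s` for `Θ_B`, of the SAME type `δ`: roots `ζ′_M := ζ_{νM}^ν`, tower
`lift′_M(a) := u_s(Λ.lift_{νM}(γ⋆ ã))` — well defined and `M`-torsion because `γ⋆(Mℤ^{2g})` maps into the kernel,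
injective because the kernel is exactly that and `γγ⋆ = ν` (γ integral), bijective by counting (`#B_s[M] = M^{2g}`, ★
`natCard_torsionPoints_eq_of_isAlgClosed`), compatible by ★ `lift_compat`, equal to `ψφ(s)` at level `N` by
`γ ≡ 1 (mod N)`, and symplectic by (W′) + `E_δ(γ⋆x, γ⋆y) = νE_δ(x, y)`.  [Lan2013PELCompactifications] §1.3.6 with
[Deligne1971TravauxShimura] 4.11 «l'action de `G(𝔸_f)` … se décrit en termes d'isogénies»; the Weil-pairing functoriality is
[MumfordAV1970] §20 (3). [cite: Lan2013PELCompactifications, §1.3.6 Def. 1.3.6.2 (p. 80) and Lemma 1.3.6.5 (p. 81)]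
[cite: Deligne1971TravauxShimura, 4.11–4.12 pp. 148–149] [cite: MumfordAV1970, §20 (property (3) of e_n, p. 186)] -/
theorem nonempty_of_isogeny [IsAlgClosed Ω] (Λ : φ'.SymplecticLift s ΘA δ) (hN : N ≠ 0) (hν : ν ≠ 0)
    (u : A.X ⟶ B.X) [IsMonHom u] {ψφ : B.LevelStructure g N} (hψφ : ∀ i, ψφ.σ i = (φ'.σ i ^ ν) ≫ u)
    (hB : B.IsOfRelDim g)
    (γm γs : Matrix (Fin g ⊕ Fin g) (Fin g ⊕ Fin g) ℤ) (hγ : γm * γs = (ν : ℤ) • (1 : Matrix _ _ ℤ))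
    (hγ' : γs * γm = (ν : ℤ) • (1 : Matrix _ _ ℤ)) (hsim : γsᵀ * typeForm δ * γs = (ν : ℤ) • typeForm δ)
    (hQA4 : ∀ k i, (N : ℤ) ∣ (γm - 1) k i)
    (hker : ∀ P : (A.fibre s).toAbelianVariety.Points Ω, AlgPoints.map (fibreHom u s).hom.hom.hom P = 1 ↔
      ∃ z : Fin g ⊕ Fin g → ℤ, P = A.restrictPt s (φ'.section_ fun j => ((((N : ℤ) * (γs *ᵥ z) j : ℤ)) : ZMod (N * ν))))
    {ΘB : CartierDivisor (B.fibre s).toAbelianVariety.X.left}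
    (hW : ∀ ⦃M : ℕ⦄, N ∣ M → ∀ (hMΩ : (M : Ω) ≠ 0) (hνMΩ : ((ν * M : ℕ) : Ω) ≠ 0)
      (a b : (A.fibre s).toAbelianVariety.torsionPoints Ω ((ν * M : ℕ) : ℤ))
      (P Q : (B.fibre s).toAbelianVariety.torsionPoints Ω (M : ℤ)),
      (P : (B.fibre s).toAbelianVariety.Points Ω) = AlgPoints.map (fibreHom u s).hom.hom.hom a →
      (Q : (B.fibre s).toAbelianVariety.Points Ω) = AlgPoints.map (fibreHom u s).hom.hom.hom b →
      haveI := AbelianVariety.isDominant_toSchemeHom_zsmul_of_ne_zero (B.fibre s).toAbelianVariety hMΩ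
      haveI := AbelianVariety.isDominant_toSchemeHom_zsmul_of_ne_zero (A.fibre s).toAbelianVariety hνMΩ
      (B.fibre s).toAbelianVariety.weilPairingLevel ΘB P Q =
        (A.fibre s).toAbelianVariety.weilPairingLevel ΘA a b) :
    Nonempty (ψφ.SymplecticLift s ΘB δ) := by
  classical
  haveI : NeZero N := ⟨hN⟩
  have hNν : N * ν ≠ 0 := Nat.mul_ne_zero hN hν
  have hker₁ : ∀ z : Fin g ⊕ Fin g → ℤ, AlgPoints.map (fibreHom u s).hom.hom.hom
      (A.restrictPt s (φ'.section_ fun j => ((((N : ℤ) * (γs *ᵥ z) j : ℤ)) : ZMod (N * ν)))) = 1 :=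
    fun z => (hker _).2 ⟨z, rfl⟩
  have hker₂ : ∀ P : (A.fibre s).toAbelianVariety.Points Ω, AlgPoints.map (fibreHom u s).hom.hom.hom P = 1 →
      ∃ z : Fin g ⊕ Fin g → ℤ, P = A.restrictPt s (φ'.section_ fun j => ((((N : ℤ) * (γs *ᵥ z) j : ℤ)) : ZMod (N * ν))) :=
    fun P h => (hker P).1 h
  have hdvd : ∀ {M : ℕ}, N ∣ M → N * ν ∣ ν * M := fun ⟨k, hk⟩ => ⟨k, by rw [hk]; ring⟩
  -- the point map lands in the `M`-torsion
  have hmem : ∀ {M : ℕ}, N ∣ M → M ≠ 0 → ∀ w : Fin g ⊕ Fin g → ℤ,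
      AlgPoints.map (fibreHom u s).hom.hom.hom
        ((Λ.lift (ν * M) (Multiplicative.ofAdd fun j => (((γs *ᵥ w) j : ℤ) : ZMod (ν * M)))) :
          (A.fibre s).toAbelianVariety.Points Ω) ∈ (B.fibre s).toAbelianVariety.torsionPoints Ω (M : ℤ) := by
    intro M hNM hM w
    rw [AbelianVariety.mem_torsionPoints_iff, zpow_natCast]
    exact Λ.map_lift_mulVec_pow_eq_one u γs hN hν hker₁ hNM hM w
  -- the tower of `B` at `s`
  let liftB : ∀ M : ℕ, Multiplicative (Fin g ⊕ Fin g → ZMod M) →*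
      (B.fibre s).toAbelianVariety.torsionPoints Ω (M : ℤ) := fun M =>
    if h : N ∣ M ∧ M ≠ 0 then
      MonoidHom.mk'
        (fun x => ⟨AlgPoints.map (fibreHom u s).hom.hom.hom
          ((Λ.lift (ν * M) (Multiplicative.ofAdd fun j =>
            (((γs *ᵥ fun k => ((Multiplicative.toAdd x k).val : ℤ)) j : ℤ) : ZMod (ν * M)))) :
              (A.fibre s).toAbelianVariety.Points Ω), hmem h.1 h.2 _⟩)
        (fun x y => Subtype.ext (by
          haveI : NeZero M := ⟨h.2⟩
          change AlgPoints.map (fibreHom u s).hom.hom.hom _ =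
            AlgPoints.map (fibreHom u s).hom.hom.hom _ * AlgPoints.map (fibreHom u s).hom.hom.hom _
          rw [← Λ.map_lift_mulVec_add u γs]
          refine Λ.map_lift_mulVec_congr u γs hN hν hker₁ h.1 h.2 fun j => ?_
          rw [toAdd_mul, Pi.add_apply, Pi.add_apply, Int.cast_add, Int.cast_natCast, Int.cast_natCast,
            Int.cast_natCast, ZMod.natCast_zmod_val, ZMod.natCast_zmod_val, ZMod.natCast_zmod_val]))
    else 1
  have hliftB : ∀ {M : ℕ} (hNM : N ∣ M) (hM : M ≠ 0) (x : Fin g ⊕ Fin g → ZMod M),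
      ((liftB M (Multiplicative.ofAdd x) : (B.fibre s).toAbelianVariety.torsionPoints Ω (M : ℤ)) :
          (B.fibre s).toAbelianVariety.Points Ω) =
        AlgPoints.map (fibreHom u s).hom.hom.hom
          ((Λ.lift (ν * M) (Multiplicative.ofAdd fun j =>
            (((γs *ᵥ fun k => ((x k).val : ℤ)) j : ℤ) : ZMod (ν * M)))) : (A.fibre s).toAbelianVariety.Points Ω) := by
    intro M hNM hM x
    simp only [liftB, dif_pos (And.intro hNM hM)]
    rfl
  refine ⟨{ ζ := fun M => Λ.ζ (ν * M) ^ ν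
            isPrimitiveRoot_ζ := ?_
            ζ_pow := ?_
            lift := liftB
            lift_bijective := ?_
            lift_compat := ?_
            lift_level := ?_
            pairing := ?_ }⟩
  · -- `ζ_{νM}^ν` is a primitive `M`-th root
    intro M hNM hM
    exact (Λ.isPrimitiveRoot_ζ (hdvd hNM) (Nat.mul_ne_zero hν hM)).pow
      (Nat.pos_of_ne_zero (Nat.mul_ne_zero hν hM)) rfl
  · -- compatibility of the roots
    intro M k hNM hM hk
    rw [Nat.mul_left_comm ν k M, ← pow_mul, mul_comm ν k, pow_mul,
      Λ.ζ_pow k (hdvd hNM) (Nat.mul_ne_zero hν hM) hk]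
  · -- bijectivity: injective by the exact kernel, then counting
    intro M hNM hM
    haveI : NeZero M := ⟨hM⟩
    have hinj : Function.Injective (liftB M) := by
      rw [injective_iff_map_eq_one]
      intro x hx
      have hx' := congrArg (fun P : (B.fibre s).toAbelianVariety.torsionPoints Ω (M : ℤ) =>
        (P : (B.fibre s).toAbelianVariety.Points Ω)) hx
      rw [show x = Multiplicative.ofAdd (Multiplicative.toAdd x) from rfl, hliftB hNM hM, OneMemClass.coe_one] at hx'
      obtain ⟨z, hz⟩ := Λ.exists_eq_smul_of_map_lift_mulVec_eq_one u γs hN hν γm hγ hker₂ hNM hM hx'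
      rw [show x = Multiplicative.ofAdd (Multiplicative.toAdd x) from rfl, ← ofAdd_zero]
      congr 1
      funext k
      have hk := congrFun hz k
      rw [Pi.smul_apply, smul_eq_mul] at hk
      rw [Pi.zero_apply, ← ZMod.natCast_zmod_val (Multiplicative.toAdd x k), ← Int.cast_natCast, hk,
        Int.cast_mul, Int.cast_natCast, ZMod.natCast_self, zero_mul]
    have hMΩ : (M : Ω) ≠ 0 := Λ.natCast_ne_zero hNν hM
    have hcardB : Nat.card ((B.fibre s).toAbelianVariety.torsionPoints Ω (M : ℤ)) = M ^ (2 * g) := by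
      rw [(B.fibre s).toAbelianVariety.natCard_torsionPoints_eq_of_isAlgClosed Ω (M : ℤ) (by exact_mod_cast hMΩ),
        B.dim_fibre_of_isOfRelDim hB s, Int.natAbs_natCast]
    have hcardD : Nat.card (Multiplicative (Fin g ⊕ Fin g → ZMod M)) = M ^ (2 * g) := by
      rw [Nat.card_eq_fintype_card, Fintype.card_multiplicative, Fintype.card_fun, ZMod.card, Fintype.card_sum,
        Fintype.card_fin, two_mul]
    haveI : Finite ((B.fibre s).toAbelianVariety.torsionPoints Ω (M : ℤ)) := by
      apply Nat.finite_of_card_ne_zero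
      rw [hcardB]
      exact pow_ne_zero _ hM
    exact hinj.bijective_of_nat_card_le (by rw [hcardB, hcardD])
  · -- tower compatibility
    intro M k x hNM hM hk
    haveI : NeZero M := ⟨hM⟩
    have hkM : N ∣ k * M := dvd_mul_of_dvd_right hNM k
    have hkM0 : k * M ≠ 0 := Nat.mul_ne_zero hk hM
    haveI : NeZero (k * M) := ⟨hkM0⟩
    change ((liftB M (Multiplicative.ofAdd _) : (B.fibre s).toAbelianVariety.torsionPoints Ω (M : ℤ)) :
        (B.fibre s).toAbelianVariety.Points Ω) =
      ((liftB (k * M) (Multiplicative.ofAdd x) : (B.fibre s).toAbelianVariety.torsionPoints Ω ((k * M : ℕ) : ℤ)) :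
        (B.fibre s).toAbelianVariety.Points Ω) ^ k
    rw [hliftB hNM hM, hliftB hkM hkM0, ← map_fibreHom_pow' s u,
      Λ.coe_lift_intCast_congr (Nat.mul_left_comm ν k M) (γs *ᵥ fun k' => ((x k').val : ℤ)),
      ← Λ.lift_compat k _ (hdvd hNM) (Nat.mul_ne_zero hν hM) hk]
    have hcast : (fun i => ZMod.castHom (Dvd.intro_left k rfl) (ZMod (ν * M))
        ((fun j => (((γs *ᵥ fun k' => ((x k').val : ℤ)) j : ℤ) : ZMod (k * (ν * M)))) i)) =
        fun j => (((γs *ᵥ fun k' => ((x k').val : ℤ)) j : ℤ) : ZMod (ν * M)) := by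
      funext j
      exact map_intCast _ _
    rw [hcast]
    refine Λ.map_lift_mulVec_congr u γs hN hν hker₁ hNM hM fun j => ?_
    rw [Int.cast_natCast, Int.cast_natCast, ZMod.natCast_zmod_val, ZMod.castHom_apply, ZMod.cast_eq_val]
  · -- at level `N`
    intro i
    rw [hliftB dvd_rfl hN]
    exact Λ.map_lift_mulVec_single u γs hN hν γm hγ' hQA4 hker₁ hψφ i
  · -- the pairing: (W′) + `Λ.pairing` at level `νM` + `E(γ⋆x, γ⋆y) = νE(x, y)`
    intro M hNM hMΩ x y
    have hM : M ≠ 0 := by rintro rfl; exact hMΩ (by rw [Nat.cast_zero])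
    haveI : NeZero M := ⟨hM⟩
    haveI : NeZero (ν * M) := ⟨Nat.mul_ne_zero hν hM⟩
    have hνMΩ : ((ν * M : ℕ) : Ω) ≠ 0 := Λ.natCast_ne_zero hNν (Nat.mul_ne_zero hν hM)
    haveI := AbelianVariety.isDominant_toSchemeHom_zsmul_of_ne_zero (B.fibre s).toAbelianVariety hMΩ
    haveI := AbelianVariety.isDominant_toSchemeHom_zsmul_of_ne_zero (A.fibre s).toAbelianVariety hνMΩ
    have hP := hliftB hNM hM x
    have hQ := hliftB hNM hM y
    rw [hW hNM hMΩ hνMΩ _ _ _ _ hP hQ, Λ.weilPairingLevel_lift (hdvd hNM) hνMΩ, typeFormMod_intCast,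
      sum_sum_typeForm_mulVec δ γs hsim, val_intCast_mul_eq, pow_mul]
    -- the target exponent is the residue mod `M` of the same integer form
    have hx : (fun k => ((((x k).val : ℤ) : ℤ) : ZMod M)) = x := funext fun k => by
      rw [Int.cast_natCast, ZMod.natCast_zmod_val]
    have hy : (fun k => ((((y k).val : ℤ) : ℤ) : ZMod M)) = y := funext fun k => by
      rw [Int.cast_natCast, ZMod.natCast_zmod_val]
    conv_rhs => rw [← hx, ← hy, typeFormMod_intCast]

end LevelStructure.SymplecticLift

/-! ### §6 Over the base: symplectic-liftability transfers along the isogeny (the `symplectic` field of the quotient triple) -/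

/-- **(T3) SYMPLECTIC-LIFTABILITY TRANSFERS ALONG A HECKE ISOGENY** — the isogeny analogue of ★ (T2)
`IsSymplecticLiftable.of_fibreIso`; [Lan2013PELCompactifications] Lemma 1.3.6.6 (liftability is tested geometric point by
geometric point).  Let `u : A → B` be a homomorphism of abelian schemes over `S`, `B` of relative dimension `g`, `φ′` a
level-`N·ν` structure on `A` and `ψφ = u ∘ φ′^ν` the induced level-`N` structure on `B` (★ `LevelStructureOfIsogeny`); let
`γ, γ⋆` be integer matrices with `γγ⋆ = γ⋆γ = ν`, `ᵗγ⋆E_δγ⋆ = νE_δ`, `γ ≡ 1 (mod N)`, such that at EVERY geometric point the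
kernel of `u_s` on `Ω`-points is exactly `φ′(N·γ⋆ℤ^{2g})(s)`; and suppose the POLARISATION TRANSFER `hpol`: at every
geometric point, every ample witness `Θ_B` of `λ̄_B` admits an ample witness `Θ_A` of `λ̄_A` satisfying the mixed-level
Weil clause (W′) `ē^{Θ_B}_M(u a, u b) = ē^{Θ_A}_{νM}(a, b)` (`a, b ∈ A_s[νM]`, `u a, u b ∈ B_s[M]`, `N ∣ M`).  If `φ′` is
symplectic-liftable of type `δ` for `λ_A`, then `ψφ` is symplectic-liftable of type `δ` for `λ_B` (pointwise: ★
`SymplecticLift.nonempty_of_isogeny`). [cite: Lan2013PELCompactifications, §1.3.6 Lemma 1.3.6.6 and Cor. 1.3.6.7 (pp. 81–82)]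
[cite: Deligne1971TravauxShimura, 4.11–4.12 pp. 148–149] [cite: MumfordAV1970, §20 (property (3) of e_n, p. 186)] -/
theorem LevelStructure.IsSymplecticLiftable.of_fibreIsogeny {g N ν : ℕ} (hN : N ≠ 0) (hν : ν ≠ 0)
    {φ' : A.LevelStructure g (N * ν)} {DA : A.DualPair} {polA : A.Polarization DA}
    {DB : B.DualPair} {polB : B.Polarization DB} {δ : Fin g → ℕ}
    (u : A.X ⟶ B.X) [IsMonHom u] {ψφ : B.LevelStructure g N} (hψφ : ∀ i, ψφ.σ i = (φ'.σ i ^ ν) ≫ u)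
    (hB : B.IsOfRelDim g)
    (γm γs : Matrix (Fin g ⊕ Fin g) (Fin g ⊕ Fin g) ℤ) (hγ : γm * γs = (ν : ℤ) • (1 : Matrix _ _ ℤ))
    (hγ' : γs * γm = (ν : ℤ) • (1 : Matrix _ _ ℤ)) (hsim : γsᵀ * typeForm δ * γs = (ν : ℤ) • typeForm δ)
    (hQA4 : ∀ k i, (N : ℤ) ∣ (γm - 1) k i)
    (hker : ∀ (Ω : Type u) [Field Ω] [IsAlgClosed Ω] (s : Spec (.of Ω) ⟶ S)
      (P : (A.fibre s).toAbelianVariety.Points Ω), AlgPoints.map (fibreHom u s).hom.hom.hom P = 1 ↔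
        ∃ z : Fin g ⊕ Fin g → ℤ,
          P = A.restrictPt s (φ'.section_ fun j => ((((N : ℤ) * (γs *ᵥ z) j : ℤ)) : ZMod (N * ν))))
    (hpol : ∀ (Ω : Type u) [Field Ω] [IsAlgClosed Ω] (s : Spec (.of Ω) ⟶ S)
      (ΘB : CartierDivisor (B.fibre s).toAbelianVariety.X.left), ΘB.IsAmple → B.IsLambdaOfAt s DB polB.lam ΘB →
      ∃ ΘA : CartierDivisor (A.fibre s).toAbelianVariety.X.left, ΘA.IsAmple ∧ A.IsLambdaOfAt s DA polA.lam ΘA ∧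
        ∀ ⦃M : ℕ⦄, N ∣ M → ∀ (hMΩ : (M : Ω) ≠ 0) (hνMΩ : ((ν * M : ℕ) : Ω) ≠ 0)
          (a b : (A.fibre s).toAbelianVariety.torsionPoints Ω ((ν * M : ℕ) : ℤ))
          (P Q : (B.fibre s).toAbelianVariety.torsionPoints Ω (M : ℤ)),
          (P : (B.fibre s).toAbelianVariety.Points Ω) = AlgPoints.map (fibreHom u s).hom.hom.hom a →
          (Q : (B.fibre s).toAbelianVariety.Points Ω) = AlgPoints.map (fibreHom u s).hom.hom.hom b →
          haveI := AbelianVariety.isDominant_toSchemeHom_zsmul_of_ne_zero (B.fibre s).toAbelianVariety hMΩ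
          haveI := AbelianVariety.isDominant_toSchemeHom_zsmul_of_ne_zero (A.fibre s).toAbelianVariety hνMΩ
          (B.fibre s).toAbelianVariety.weilPairingLevel ΘB P Q =
            (A.fibre s).toAbelianVariety.weilPairingLevel ΘA a b)
    (h : φ'.IsSymplecticLiftable polA δ) : ψφ.IsSymplecticLiftable polB δ := by
  intro Ω _ _ s ΘB hΘB hlamB
  obtain ⟨ΘA, hΘA, hlamA, hW⟩ := hpol Ω s ΘB hΘB hlamB
  obtain ⟨Λ⟩ := h Ω s ΘA hΘA hlamA
  exact Λ.nonempty_of_isogeny hN hν u hψφ hB γm γs hγ hγ' hsim hQA4 (hker Ω s) hW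

/-- **THE LEVEL FIELDS OF A HECKE ISOGENY QUOTIENT, in one call** (★ H3 `exists_σ_eq_pow_comp_of_coprime` + (T3)): under
the hypotheses of `of_fibreIsogeny` and of the coprime transport (`Nat.Coprime ν N`, `u` onto on geometric fibre points,
kernel killed by `ν`), a symplectic-liftable level-`N·ν` structure `φ′` on `A` yields a level-`N` structure `ψ` on `B`
with `ψ.σ i = (φ′.σ i ^ ν) ≫ u`, symplectic-liftable of the SAME type `δ` for `λ_B` — the `level`/`symplectic` fields of
the quotient triple the classifying map of the Hecke correspondence consumes.
[cite: Lan2013PELCompactifications, §1.3.6 Def. 1.3.6.2 (p. 80), Lemma 1.3.6.6 and Cor. 1.3.6.7 (pp. 81–82)]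
[cite: MumfordFogartyKirwan1994, Ch. 7 §1 Definition 7.1 (p. 129) and App. 7A (p. 235)]
[cite: Deligne1971TravauxShimura, 4.11–4.12 pp. 148–149] -/
theorem LevelStructure.exists_isSymplecticLiftable_of_fibreIsogeny {g N ν : ℕ} (hN : N ≠ 0) (hν : ν ≠ 0)
    {φ' : A.LevelStructure g (N * ν)} {DA : A.DualPair} {polA : A.Polarization DA}
    {DB : B.DualPair} {polB : B.Polarization DB} {δ : Fin g → ℕ}
    (u : A.X ⟶ B.X) [IsMonHom u] (hcop : Nat.Coprime ν N)
    (hsurj : ∀ ⦃Ω : Type u⦄ [Field Ω] [IsAlgClosed Ω] (s : Spec (.of Ω) ⟶ S) (y : B.FibrePoints s),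
      ∃ x : A.FibrePoints s, x ≫ u = y)
    (hkerν : ∀ ⦃Ω : Type u⦄ [Field Ω] [IsAlgClosed Ω] (s : Spec (.of Ω) ⟶ S) (x : A.FibrePoints s),
      x ≫ u = 1 → x ^ ν = 1)
    (hB : B.IsOfRelDim g)
    (γm γs : Matrix (Fin g ⊕ Fin g) (Fin g ⊕ Fin g) ℤ) (hγ : γm * γs = (ν : ℤ) • (1 : Matrix _ _ ℤ))
    (hγ' : γs * γm = (ν : ℤ) • (1 : Matrix _ _ ℤ)) (hsim : γsᵀ * typeForm δ * γs = (ν : ℤ) • typeForm δ)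
    (hQA4 : ∀ k i, (N : ℤ) ∣ (γm - 1) k i)
    (hker : ∀ (Ω : Type u) [Field Ω] [IsAlgClosed Ω] (s : Spec (.of Ω) ⟶ S)
      (P : (A.fibre s).toAbelianVariety.Points Ω), AlgPoints.map (fibreHom u s).hom.hom.hom P = 1 ↔
        ∃ z : Fin g ⊕ Fin g → ℤ,
          P = A.restrictPt s (φ'.section_ fun j => ((((N : ℤ) * (γs *ᵥ z) j : ℤ)) : ZMod (N * ν))))
    (hpol : ∀ (Ω : Type u) [Field Ω] [IsAlgClosed Ω] (s : Spec (.of Ω) ⟶ S)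
      (ΘB : CartierDivisor (B.fibre s).toAbelianVariety.X.left), ΘB.IsAmple → B.IsLambdaOfAt s DB polB.lam ΘB →
      ∃ ΘA : CartierDivisor (A.fibre s).toAbelianVariety.X.left, ΘA.IsAmple ∧ A.IsLambdaOfAt s DA polA.lam ΘA ∧
        ∀ ⦃M : ℕ⦄, N ∣ M → ∀ (hMΩ : (M : Ω) ≠ 0) (hνMΩ : ((ν * M : ℕ) : Ω) ≠ 0)
          (a b : (A.fibre s).toAbelianVariety.torsionPoints Ω ((ν * M : ℕ) : ℤ))
          (P Q : (B.fibre s).toAbelianVariety.torsionPoints Ω (M : ℤ)),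
          (P : (B.fibre s).toAbelianVariety.Points Ω) = AlgPoints.map (fibreHom u s).hom.hom.hom a →
          (Q : (B.fibre s).toAbelianVariety.Points Ω) = AlgPoints.map (fibreHom u s).hom.hom.hom b →
          haveI := AbelianVariety.isDominant_toSchemeHom_zsmul_of_ne_zero (B.fibre s).toAbelianVariety hMΩ
          haveI := AbelianVariety.isDominant_toSchemeHom_zsmul_of_ne_zero (A.fibre s).toAbelianVariety hνMΩ
          (B.fibre s).toAbelianVariety.weilPairingLevel ΘB P Q =
            (A.fibre s).toAbelianVariety.weilPairingLevel ΘA a b)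
    (h : φ'.IsSymplecticLiftable polA δ) :
    ∃ ψ : B.LevelStructure g N, (∀ i, ψ.σ i = (φ'.σ i ^ ν) ≫ u) ∧ ψ.IsSymplecticLiftable polB δ := by
  obtain ⟨ψ, hψ⟩ := φ'.exists_σ_eq_pow_comp_of_coprime (Nat.mul_ne_zero hN hν) u hcop hsurj hkerν
  exact ⟨ψ, hψ, LevelStructure.IsSymplecticLiftable.of_fibreIsogeny hN hν u hψ hB γm γs hγ hγ' hsim hQA4 hker hpol h⟩

end AbelianSchemeOver

end Literature.AlgebraicGeometry.AbelianSchemes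

end
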